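import Summits.QuantumFields.YangMills.Theorems.LuscherReductionTwistedTraceScalingBOStiffWeightTransport
import Summits.QuantumFields.YangMills.Theorems.LuscherReductionTwistedTraceScalingBOStiffCoreData
import Summits.QuantumFields.YangMills.Theorems.FlatTubeReductionRecordSupportK
import Summits.QuantumFields.YangMills.Theorems.FlatTubeReductionStiffKDefs
import HarnessLib


/-!
# (B-ST) K-port, part 1: WEIGHT TRANSPORT across the slow variable and the record weight data, at a GENERAL CAP CONSTANT `K ≥ 1`
# (route `FlatTubeReduction`, crux K1 `NearFlatRatioLaw` stmt-QuantumFields-24720, line `ratepack_v2`, stub `stub_hST_A`; seat `ym-line-ftr-p1` g20; R2b1 RECORD rung — no summit statement is proved here)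

Lane A's ✓`…BOStiffWeightTransport` / ✓`…BOStiffCoreCoeff` §2 / ✓`…BOStiffCoreData` §1,§3 VERBATIM with the cap constant `43` of `recordChi L s 43 M β` replaced by a parameter `K ≥ 1`
(the rate twin's stub `stub_hST_A` needs `K = 42·max 1 (|Site 3 L|/7) + 1` at `s = 1/6`), in the K-vocabulary `cWK` of ✓`…FlatTubeReductionStiffKDefs`:
* `eventually_orthoTube_one_mem_fatTube_K`, `eventually_orthoTube_one_mem_fatTube_of_norm_le_K` — the reference fibre over the profile ball lies in the fat tube of radius `Kβ^{-s}`;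
* `fpWeight_record_sandwich_K` ((P) for the record weight), ★★ `eventually_core_weight_transport_K`, ★★★ `eventually_core_sq_norm_transport_K`;
* `cWK_props`, `fibreMass_eq_cMass_K`, ★★ `eventually_cWK_floor`.
HONEST FRAMING: text port (slot substitution `43 ↦ K`) of lane A's bookkeeping for a stub of the crux K1 of the CONDITIONAL route R2b1 (RECORD rung); no new mathematics; not infinite volume,
not a gap, not Clay.
-/

set_option autoImplicit false

noncomputable section

open MeasureTheory Filter Topology Real
open scoped BigOperators
open Literature.MathematicalPhysics.QuantumFieldTheory
open Literature.MathematicalPhysics.QuantumLattice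

namespace Summit.QuantumFields.YangMills.Theorems.FemtoTransferGap.TwoLattice.ConstTube

open Summit.QuantumFields.YangMills.Theorems.FemtoTransferGap
open Summit.QuantumFields.YangMills.Theorems.FemtoTransferGap.TwoLattice
open Summit.QuantumFields.YangMills.Theorems.FemtoTransferGap.TwoLattice.Avg
open Summit.QuantumFields.YangMills.Theorems.FemtoTransferGap.TwoLattice.Stiff
open Summit.QuantumFields.YangMills.Theorems.FemtoTransferGap.TwoLattice.GnChart
open Summit.QuantumFields.YangMills.Theorems.FemtoTransferGap.TwoLattice.Cov
open Summit.QuantumFields.YangMills.Theorems.FemtoTransferGap.TwoLattice.Toron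

variable {L : ℕ} [NeZero L]

/-! ## §1 The reference fibre lies in the fat tube of radius `Kβ^{-s}` -/

/-- The reference fibre lies in the fat tube: eventually in `β`, for `M ≥ 2`, every `x` with `Ω_c(x̂) ≠ 0` (so `‖x̂‖ ≤ r_f`) has `orthoTube 1 x ∈ F`. [folklore] -/
theorem eventually_orthoTube_one_mem_fatTube_K {K : ℝ} (hK : 1 ≤ K) {s : ℝ} (hs : 0 < s) (hs2 : s < 1 / 2) {M : ℝ} (hM : 2 ≤ M) :
    ∀ᶠ β : ℝ in atTop, ∀ x : Edge 3 L → Fin 3 → ℝ,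
      {x : LinkSpace L | linkCurry x ∈ capBalancedSet L}.indicator (fun _ => (1 : ℝ)) (linkEmbed L x) *
          frozenProfile L (fun β' => stiffGaussExp L (β' / 2) β') (fun β' => min (1 / 40) (powScale (1 / 2) β' * btLog β')) β (linkEmbed L x) ≠ 0 →
        orthoTube L 1 x ∈ fatTubeRho L (fun β => K * powScale s β) (fun b => M * (K * powScale s b)) β := by
  have ht : Tendsto (fun β : ℝ => powScale (1 / 2 - s) β * btLog β) atTop (𝓝 0) := by
    have h := tendsto_powScale_mul_btLog_pow (p := 1 / 2 - s) (by linarith) 1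
    simpa using h
  have hE0 : (0 : ℝ) < Fintype.card (Edge 3 L) := by exact_mod_cast Fintype.card_pos
  have c0 : (0 : ℝ) < 1 / (4 * Fintype.card (Edge 3 L) + 1) := by positivity
  filter_upwards [ht.eventually (gt_mem_nhds c0)] with β hβ x hx
  have hps : 0 < powScale s β := powScale_pos _ _
  have hsplit : powScale (1 / 2) β = powScale (1 / 2 - s) β * powScale s β := by
    rw [powScale_mul_powScale]; ring_nf
  set t := powScale (1 / 2 - s) β * btLog β with htdef
  have ht0 : 0 ≤ t := mul_nonneg (powScale_pos _ _).le (zero_le_one.trans (one_le_btLog β))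
  have hrf : min (1 / 40) (powScale (1 / 2) β * btLog β) ≤ t * powScale s β := by
    rw [hsplit]; refine (min_le_right _ _).trans (le_of_eq (by rw [htdef]; ring))
  have ht1 : t * (4 * Fintype.card (Edge 3 L) + 1) < 1 := by
    have := (lt_div_iff₀ (by positivity : (0 : ℝ) < 4 * Fintype.card (Edge 3 L) + 1)).mp hβ; linarith
  have hrhalf : min (1 / 40) (powScale (1 / 2) β * btLog β) ≤ 1 / 2 := (min_le_left _ _).trans (by norm_num)
  have hΩR : ∀ y : LinkSpace L, {x : LinkSpace L | linkCurry x ∈ capBalancedSet L}.indicator (fun _ => (1 : ℝ)) y *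
      frozenProfile L (fun β' => stiffGaussExp L (β' / 2) β') (fun β' => min (1 / 40) (powScale (1 / 2) β' * btLog β')) β y ≠ 0 →
      ‖y‖ ≤ min (1 / 40) (powScale (1 / 2) β * btLog β) := fun y hy => norm_le_of_frozenProfile_ne_zero _ _ β (right_ne_zero_of_mul hy)
  have hu : orbitDist (1 : GaugeConfig 3 1 SU2) ≤ 0 := by
    rw [show (1 : GaugeConfig 3 1 SU2) = fun _ => (1 : SU2) from rfl, orbitDist_one]
  refine orthoTube_mem_fatTubeRho (δ' := fun β : ℝ => K * powScale s β) (ρ := fun b => M * (K * powScale s b)) hu hrhalf hΩR ?_ ?_ x hx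
  · show 4 * min (1 / 40) (powScale (1 / 2) β * btLog β) + 0 < M * (K * powScale s β)
    have hE1 : (1 : ℝ) ≤ Fintype.card (Edge 3 L) := by exact_mod_cast Fintype.card_pos
    have h5t : 5 * t < 1 := by nlinarith [mul_le_mul_of_nonneg_left hE1 ht0]
    have hMK : 2 * powScale s β ≤ M * (K * powScale s β) := by
      have hmk : 2 * 1 ≤ M * K := mul_le_mul hM hK zero_le_one (by linarith)
      nlinarith [mul_le_mul_of_nonneg_right hmk hps.le]
    nlinarith [mul_le_mul_of_nonneg_left hrf (by norm_num : (0 : ℝ) ≤ 4), mul_lt_mul_of_pos_right h5t hps]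
  · show (Fintype.card (Edge 3 L) : ℝ) * (4 * min (1 / 40) (powScale (1 / 2) β * btLog β) + 0) < K * powScale s β
    have h1 : (Fintype.card (Edge 3 L) : ℝ) * (4 * (t * powScale s β)) < 1 * powScale s β := by
      have : 4 * (Fintype.card (Edge 3 L) : ℝ) * t < 1 := by nlinarith
      nlinarith
    have h2 : 1 * powScale s β ≤ K * powScale s β := mul_le_mul_of_nonneg_right hK hps.le
    nlinarith [mul_le_mul_of_nonneg_left hrf (by positivity : (0 : ℝ) ≤ 4 * (Fintype.card (Edge 3 L) : ℝ))]

/-- ★ **The reference fibre over the profile ball lies in the fat tube**, eventually in `β` (`M ≥ 2`, `0 < s < 1/2`): `‖x̂‖ ≤ r_f ⇒ orthoTube 1 x ∈ F`. [folklore] -/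
theorem eventually_orthoTube_one_mem_fatTube_of_norm_le_K {K : ℝ} (hK : 1 ≤ K) {s : ℝ} (hs : 0 < s) (hs2 : s < 1 / 2) {M : ℝ} (hM : 2 ≤ M) :
    ∀ᶠ β : ℝ in atTop, ∀ x : Edge 3 L → Fin 3 → ℝ, ‖linkEmbed L x‖ ≤ min (1 / 40) (powScale (1 / 2) β * btLog β) →
      orthoTube L 1 x ∈ fatTubeRho L (fun β => K * powScale s β) (fun b => M * (K * powScale s b)) β := by
  have ht : Tendsto (fun β : ℝ => powScale (1 / 2 - s) β * btLog β) atTop (𝓝 0) := by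
    have h := tendsto_powScale_mul_btLog_pow (p := 1 / 2 - s) (by linarith) 1
    simpa using h
  have hE0 : (0 : ℝ) < Fintype.card (Edge 3 L) := by exact_mod_cast Fintype.card_pos
  have c0 : (0 : ℝ) < 1 / (4 * Fintype.card (Edge 3 L) + 1) := by positivity
  filter_upwards [ht.eventually (gt_mem_nhds c0)] with β hβ x hx
  have hps : 0 < powScale s β := powScale_pos _ _
  have hsplit : powScale (1 / 2) β = powScale (1 / 2 - s) β * powScale s β := by
    rw [powScale_mul_powScale]; ring_nf
  set t := powScale (1 / 2 - s) β * btLog β with htdef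
  have ht0 : 0 ≤ t := mul_nonneg (powScale_pos _ _).le (zero_le_one.trans (one_le_btLog β))
  have hrf : min (1 / 40) (powScale (1 / 2) β * btLog β) ≤ t * powScale s β := by
    rw [hsplit]; refine (min_le_right _ _).trans (le_of_eq (by rw [htdef]; ring))
  have ht1 : t * (4 * Fintype.card (Edge 3 L) + 1) < 1 := by
    have := (lt_div_iff₀ (by positivity : (0 : ℝ) < 4 * Fintype.card (Edge 3 L) + 1)).mp hβ; linarith
  have hrhalf : min (1 / 40) (powScale (1 / 2) β * btLog β) ≤ 1 / 2 := (min_le_left _ _).trans (by norm_num)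
  -- the ball indicator as a profile supported in the `r_f`-ball
  set Ω : LinkSpace L → ℝ := (Metric.closedBall (0 : LinkSpace L) (min (1 / 40) (powScale (1 / 2) β * btLog β))).indicator fun _ => (1 : ℝ) with hΩdef
  have hΩR : ∀ y : LinkSpace L, Ω y ≠ 0 → ‖y‖ ≤ min (1 / 40) (powScale (1 / 2) β * btLog β) := fun y hy => by
    by_contra h
    exact hy (Set.indicator_of_notMem (by simpa [Metric.mem_closedBall, dist_zero_right] using h) _)
  have hΩx : Ω (linkEmbed L x) ≠ 0 := by
    rw [hΩdef, Set.indicator_of_mem (by simpa [Metric.mem_closedBall, dist_zero_right] using hx)]; exact one_ne_zero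
  have hu : orbitDist (1 : GaugeConfig 3 1 SU2) ≤ 0 := by
    rw [show (1 : GaugeConfig 3 1 SU2) = fun _ => (1 : SU2) from rfl, orbitDist_one]
  refine orthoTube_mem_fatTubeRho (δ' := fun β : ℝ => K * powScale s β) (ρ := fun b => M * (K * powScale s b)) hu hrhalf hΩR ?_ ?_ x hΩx
  · show 4 * min (1 / 40) (powScale (1 / 2) β * btLog β) + 0 < M * (K * powScale s β)
    have hE1 : (1 : ℝ) ≤ Fintype.card (Edge 3 L) := by exact_mod_cast Fintype.card_pos
    have h5t : 5 * t < 1 := by nlinarith [mul_le_mul_of_nonneg_left hE1 ht0]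
    have hMK : 2 * powScale s β ≤ M * (K * powScale s β) := by
      have hmk : 2 * 1 ≤ M * K := mul_le_mul hM hK zero_le_one (by linarith)
      nlinarith [mul_le_mul_of_nonneg_right hmk hps.le]
    nlinarith [mul_le_mul_of_nonneg_left hrf (by norm_num : (0 : ℝ) ≤ 4), mul_lt_mul_of_pos_right h5t hps]
  · show (Fintype.card (Edge 3 L) : ℝ) * (4 * min (1 / 40) (powScale (1 / 2) β * btLog β) + 0) < K * powScale s β
    have h1 : (Fintype.card (Edge 3 L) : ℝ) * (4 * (t * powScale s β)) < 1 * powScale s β := by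
      have : 4 * (Fintype.card (Edge 3 L) : ℝ) * t < 1 := by nlinarith
      nlinarith
    have h2 : 1 * powScale s β ≤ K * powScale s β := mul_le_mul_of_nonneg_right hK hps.le
    nlinarith [mul_le_mul_of_nonneg_left hrf (by positivity : (0 : ℝ) ≤ 4 * (Fintype.card (Edge 3 L) : ℝ))]

/-! ## §2 ★★ The record instance at cap constant `K`, eventually in `β` -/

/-- (P) for the record weight: `∃ M₀ ≥ 2, ∀ M ≥ M₀, ∃ C ≥ 0, ∃ β₀, ∀ β ≥ β₀`, on the fat tube `N̄(1 − Cδ²) ≤ gaugeAvg (recordChi L s K M β) ≤ N̄(1 + Cδ²)`, `δ = Kβ^{-s}` (`0 < s ≤ 1/3`, `K ≥ 1`).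
[cite: Luscher1983, §3] -/
theorem fpWeight_record_sandwich_K {K : ℝ} (hK : 1 ≤ K) (hLz : Nonempty (NzSite L)) {s : ℝ} (hs : 0 < s) (hs3 : s ≤ 1 / 3) :
    ∃ M₀ : ℝ, 2 ≤ M₀ ∧ ∀ M : ℝ, M₀ ≤ M → ∃ C β₀ : ℝ, 0 ≤ C ∧ ∀ β : ℝ, β₀ ≤ β →
      ∀ U ∈ fatTubeRho L (fun β => K * powScale s β) (fun b => M * (K * powScale s b)) β,
        fpWeightBar L (powScale 1 β) * (1 - C * (K * powScale s β) ^ 2) ≤ gaugeAvg (recordChi L s K M β) U ∧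
          gaugeAvg (recordChi L s K M β) U ≤ fpWeightBar L (powScale 1 β) * (1 + C * (K * powScale s β) ^ 2) := by
  have hK0 : 0 < K := lt_of_lt_of_le one_pos hK
  have hδ0 : ∀ β, 0 < K * powScale s β := fun β => mul_pos hK0 (powScale_pos s β)
  have hδ : Tendsto (fun β => K * powScale s β) atTop (𝓝 0) := by simpa using (tendsto_powScale hs).const_mul K
  have hsd1 : ∀ᶠ β in atTop, 0 < powScale 1 β ∧ powScale 1 β ≤ (K * powScale s β) ^ 3 := by
    filter_upwards [eventually_ge_atTop (1 : ℝ)] with β hβ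
    have hp := powScale_pos 1 β
    have h1 : powScale 1 β ≤ powScale s β ^ 3 := powScale_one_le_cube hs3 hβ
    have hps0 : 0 ≤ powScale s β ^ 3 := pow_nonneg (powScale_pos s β).le 3
    refine ⟨hp, h1.trans ?_⟩
    calc powScale s β ^ 3 = 1 * powScale s β ^ 3 := (one_mul _).symm
      _ ≤ K ^ 3 * powScale s β ^ 3 := mul_le_mul_of_nonneg_right (one_le_pow₀ hK) hps0
      _ = (K * powScale s β) ^ 3 := by ring
  obtain ⟨M₀, hM₀, H⟩ := fpWeight_core_constant L hLz hδ0 hδ hsd1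
  exact ⟨M₀, hM₀, fun M hM => H M hM⟩

/-- ★★ **POINTWISE WEIGHT TRANSPORT ON THE CORE OF RECORD**: `∃ M₀ ≥ 2, ∀ M ≥ M₀, ∀ ε > 0, ∀ᶠ β, ∀ u, ∀ x ∈ cap` with `‖x̂‖ ≤ r_f` and `recordChi (orthoTube u x) ≠ 0`:
`softWeight χ (orthoTube 1 x) ≤ (1+ε)·softWeight χ (orthoTube u x)` and `softWeight χ (orthoTube u x) ≤ (1+ε)·softWeight χ (orthoTube 1 x)`. [cite: Luscher1983, §3] -/
theorem eventually_core_weight_transport_K {K : ℝ} (hK : 1 ≤ K) (hLz : Nonempty (NzSite L)) {s : ℝ} (hs : 0 < s) (hs3 : s ≤ 1 / 3) :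
    ∃ M₀ : ℝ, 2 ≤ M₀ ∧ ∀ M : ℝ, M₀ ≤ M → ∀ ε : ℝ, 0 < ε → ∀ᶠ β : ℝ in atTop, ∀ u : GaugeConfig 3 1 SU2, ∀ x ∈ capBalancedSet L,
      ‖linkEmbed L x‖ ≤ min (1 / 40) (powScale (1 / 2) β * btLog β) → recordChi L s K M β (orthoTube L u x) ≠ 0 →
        softWeight (recordChi L s K M β) (orthoTube L 1 x) ≤ (1 + ε) * softWeight (recordChi L s K M β) (orthoTube L u x) ∧
          softWeight (recordChi L s K M β) (orthoTube L u x) ≤ (1 + ε) * softWeight (recordChi L s K M β) (orthoTube L 1 x) := by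
  obtain ⟨M₀, hM₀, H⟩ := fpWeight_record_sandwich_K (L := L) hK hLz hs hs3
  refine ⟨M₀, hM₀, fun M hM ε hε => ?_⟩
  obtain ⟨C, β₀, hC, hP⟩ := H M hM
  have hM2 : 2 ≤ M := hM₀.trans hM
  have hδ : Tendsto (fun β => K * powScale s β) atTop (𝓝 0) := by simpa using (tendsto_powScale hs).const_mul K
  have hδ2 : Tendsto (fun β => (K * powScale s β) ^ 2) atTop (𝓝 0) := by simpa using hδ.pow 2
  -- `κ = Cδ² ≤ min(1/2, ε/4)` eventually, so `2κ/(1−κ) ≤ 4κ ≤ ε`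
  filter_upwards [eventually_ge_atTop β₀, eventually_mul_le_of_tendsto hδ2 C (by norm_num : (0 : ℝ) < 1 / 2), eventually_mul_le_of_tendsto hδ2 C (by positivity : (0 : ℝ) < ε / 4),
    eventually_orthoTube_one_mem_fatTube_of_norm_le_K (L := L) hK hs (by linarith) hM2] with β hβ0 hκ1 hκε hgeo u x hx hxr hχ
  set κ : ℝ := C * (K * powScale s β) ^ 2 with hκdef
  have hκ0 : 0 ≤ κ := by positivity
  set F := fatTubeRho L (fun β => K * powScale s β) (fun b => M * (K * powScale s b)) β with hFdef
  have hU : orthoTube L u x ∈ F := by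
    by_contra h; exact hχ (by rw [recordChi_eq_indicator_mul, Set.indicator_of_notMem h, zero_mul])
  have hU₁ : orthoTube L 1 x ∈ F := hgeo x hxr
  have hP' : ∀ U ∈ F, fpWeightBar L (powScale 1 β) * (1 - κ) ≤ gaugeAvg (recordChi L s K M β) U ∧ gaugeAvg (recordChi L s K M β) U ≤ fpWeightBar L (powScale 1 β) * (1 + κ) :=
    fun U hU => hP β hβ0 U hU
  have hη : 2 * κ / (1 - κ) ≤ ε := by
    rw [div_le_iff₀ (by linarith)]; nlinarith
  have hw0 : ∀ U, 0 ≤ softWeight (recordChi L s K M β) U := (softWeight_recordChi_props (L := L) s K M β).2.2.1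
  have h1 := softWeight_orthoTube_compare_two s K M β hκ0 (by linarith) hP' u 1 hx hU hU₁
  have h2 := softWeight_orthoTube_compare_two s K M β hκ0 (by linarith) hP' 1 u hx hU₁ hU
  constructor
  · have h := (abs_le.mp h1).2
    nlinarith [hw0 (orthoTube L u x), mul_le_mul_of_nonneg_right hη (hw0 (orthoTube L u x))]
  · have h := (abs_le.mp h2).2
    nlinarith [hw0 (orthoTube L 1 x), mul_le_mul_of_nonneg_right hη (hw0 (orthoTube L 1 x))]

/-- ★★★ **INTEGRATED WEIGHT TRANSPORT FOR THE CORE PIECE OF RECORD**: `∃ M₀ ≥ 2, ∀ M ≥ M₀, ∀ ε > 0, ∀ᶠ β`, for every bounded measurable `v` supported in `{recordChi L s K M β ≠ 0}`,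
with `v₁ = 𝟙_{(S₂(β)∪S₃(β))ᶜ}·v`:  `∫_u ∫_x v₁(oT u x)²·softWeight χ (oT 1 x) dπ dσ³ ≤ (1+ε)·tubeNormSq (softWeight χ) v₁` and `tubeNormSq (softWeight χ) v₁ ≤ tubeNormSq (softWeight χ) v`.
[cite: Luscher1983, §3] -/
theorem eventually_core_sq_norm_transport_K {K : ℝ} (hK : 1 ≤ K) (hLz : Nonempty (NzSite L)) {s : ℝ} (hs : 0 < s) (hs3 : s ≤ 1 / 3) :
    ∃ M₀ : ℝ, 2 ≤ M₀ ∧ ∀ M : ℝ, M₀ ≤ M → ∀ ε : ℝ, 0 < ε → ∀ᶠ β : ℝ in atTop,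
      ∀ v : GaugeConfig 3 L SU2 → ℝ, Measurable v → (∃ C : ℝ, ∀ U, |v U| ≤ C) → (∀ U, v U ≠ 0 → recordChi L s K M β U ≠ 0) →
        ∫ u, ∫ x, ({U : GaugeConfig 3 L SU2 | powScale 1 β * btLog β < ‖(gaugeModes L).starProjection (relLinkVec L U)‖} ∪
                {U : GaugeConfig 3 L SU2 | min (1 / 40) (powScale (1 / 2) β * btLog β) / 2 < ‖relLinkVec L U‖})ᶜ.indicator v (orthoTube L u x) ^ 2 *
              softWeight (recordChi L s K M β) (orthoTube L 1 x) ∂orthoTransverse L ∂configMeasure SU2 1 ≤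
          (1 + ε) * tubeNormSq (softWeight (recordChi L s K M β))
            (({U : GaugeConfig 3 L SU2 | powScale 1 β * btLog β < ‖(gaugeModes L).starProjection (relLinkVec L U)‖} ∪
                {U : GaugeConfig 3 L SU2 | min (1 / 40) (powScale (1 / 2) β * btLog β) / 2 < ‖relLinkVec L U‖})ᶜ.indicator v) ∧
        tubeNormSq (softWeight (recordChi L s K M β))
            (({U : GaugeConfig 3 L SU2 | powScale 1 β * btLog β < ‖(gaugeModes L).starProjection (relLinkVec L U)‖} ∪
                {U : GaugeConfig 3 L SU2 | min (1 / 40) (powScale (1 / 2) β * btLog β) / 2 < ‖relLinkVec L U‖})ᶜ.indicator v) ≤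
          tubeNormSq (softWeight (recordChi L s K M β)) v := by
  haveI := isFiniteMeasure_orthoTransverse L
  obtain ⟨M₀, hM₀, H⟩ := eventually_core_weight_transport_K (L := L) hK hLz hs hs3
  refine ⟨M₀, hM₀, fun M hM ε hε => ?_⟩
  have hM0 : 0 ≤ M := le_trans (by norm_num) (hM₀.trans hM)
  filter_upwards [H M hM ε hε, recordChi_support_K (L := L) hs hK hM0] with β hwt hsupp v hv hC hvs
  obtain ⟨Cv, hCv⟩ := hC
  set χ := recordChi L s K M β with hχdef
  set rf : ℝ := min (1 / 40) (powScale (1 / 2) β * btLog β) with hrfdef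
  set τ : ℝ := powScale 1 β * btLog β with hτdef
  set S₂ : Set (GaugeConfig 3 L SU2) := {U | τ < ‖(gaugeModes L).starProjection (relLinkVec L U)‖} with hS₂
  set S₃ : Set (GaugeConfig 3 L SU2) := {U | rf / 2 < ‖relLinkVec L U‖} with hS₃
  set f : GaugeConfig 3 L SU2 → ℝ := (S₂ ∪ S₃)ᶜ.indicator v with hfdef
  have hmeas : MeasurableSet (S₂ ∪ S₃)ᶜ := ((measurableSet_far_record (L := L) _).union (measurableSet_shell_record (L := L) _)).compl
  obtain ⟨hfm, hfb⟩ := indicator_piece_props hv hCv hmeas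
  obtain ⟨hwm, hwb, hw0, -⟩ := softWeight_recordChi_props (L := L) s K M β
  refine ⟨?_, tubeNormSq_indicator_le s K M β hv hCv _⟩
  -- support of `f`: in `{χ ≠ 0}`, hence in the tube set
  have hfs : ∀ U, f U ≠ 0 → χ U ≠ 0 ∧ U ∈ (S₂ ∪ S₃)ᶜ := fun U hU => by
    by_cases hmem : U ∈ (S₂ ∪ S₃)ᶜ
    · rw [hfdef, Set.indicator_of_mem hmem] at hU; exact ⟨hvs U hU, hmem⟩
    · exact absurd (Set.indicator_of_notMem hmem v) hU
  have hf0 : ∀ U, U ∉ orthoTubeSet L → f U = 0 := fun U hU => by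
    by_contra h; exact hU (hsupp U (hfs U h).1).2.2.1
  -- the right side in tube coordinates
  have hR : tubeNormSq (softWeight χ) f = ∫ p, f (orthoTube L p.1 p.2) ^ 2 * softWeight χ (orthoTube L p.1 p.2) ∂(configMeasure SU2 1).prod (orthoTransverse L) :=
    tubeNormSq_eq_tube_integral hwm hwb hfm hfb hf0
  -- the left side as a product integral
  set G : GaugeConfig 3 1 SU2 × (Edge 3 L → Fin 3 → ℝ) → ℝ := fun p => f (orthoTube L p.1 p.2) ^ 2 * softWeight χ (orthoTube L 1 p.2) with hGdef
  have hGm : Measurable G := ((hfm.comp (measurable_orthoTube L)).pow_const 2).mul (hwm.comp ((measurable_orthoTube_right 1).comp measurable_snd))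
  have hGb : ∀ p, |G p| ≤ Cv ^ 2 * Real.exp ((Fintype.card (Edge 3 L) : ℝ) / powScale 1 β ^ 2) := fun p => by
    rw [hGdef]; dsimp only; rw [abs_mul, abs_pow]
    exact mul_le_mul (pow_le_pow_left₀ (abs_nonneg _) (hfb _) 2) (hwb _) (abs_nonneg _) (sq_nonneg _)
  have hGi : Integrable G ((configMeasure SU2 1).prod (orthoTransverse L)) := integrable_of_measurable_abs_le _ hGm hGb
  have hL : ∫ u, ∫ x, f (orthoTube L u x) ^ 2 * softWeight χ (orthoTube L 1 x) ∂orthoTransverse L ∂configMeasure SU2 1 =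
      ∫ p, G p ∂(configMeasure SU2 1).prod (orthoTransverse L) := (integral_prod G hGi).symm
  -- the right-side integrand on the product
  set R : GaugeConfig 3 1 SU2 × (Edge 3 L → Fin 3 → ℝ) → ℝ := fun p => f (orthoTube L p.1 p.2) ^ 2 * softWeight χ (orthoTube L p.1 p.2) with hRdef
  have hRm : Measurable R := ((hfm.comp (measurable_orthoTube L)).pow_const 2).mul (hwm.comp (measurable_orthoTube L))
  have hRb : ∀ p, |R p| ≤ Cv ^ 2 * Real.exp ((Fintype.card (Edge 3 L) : ℝ) / powScale 1 β ^ 2) := fun p => by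
    rw [hRdef]; dsimp only; rw [abs_mul, abs_pow]
    exact mul_le_mul (pow_le_pow_left₀ (abs_nonneg _) (hfb _) 2) (hwb _) (abs_nonneg _) (sq_nonneg _)
  have hRi : Integrable R ((configMeasure SU2 1).prod (orthoTransverse L)) := integrable_of_measurable_abs_le _ hRm hRb
  -- `π`-a.e. the fibre coordinate is in the cap
  have hnull : ((configMeasure SU2 1).prod (orthoTransverse L)) (Set.univ ×ˢ (capBalancedSet L)ᶜ) = 0 := by
    rw [Measure.prod_prod, orthoTransverse_compl_capBalancedSet, mul_zero]
  have hae : ∀ᵐ p ∂(configMeasure SU2 1).prod (orthoTransverse L), p.2 ∈ capBalancedSet L := by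
    rw [ae_iff]
    refine measure_mono_null (fun p hp => ?_) hnull
    exact Set.mk_mem_prod (Set.mem_univ _) hp
  -- pointwise (a.e.): `G ≤ (1+ε)·R`
  have hpt : ∀ᵐ p ∂(configMeasure SU2 1).prod (orthoTransverse L), G p ≤ (1 + ε) * R p := by
    filter_upwards [hae] with p hp
    rw [hGdef, hRdef]; dsimp only
    by_cases hfp : f (orthoTube L p.1 p.2) = 0
    · rw [hfp]; simp
    · obtain ⟨hχp, hmem⟩ := hfs _ hfp
      have hrel : relLinkVec L (orthoTube L p.1 p.2) = linkEmbed L p.2 := relLinkVec_orthoTube L p.1 hp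
      have hxr : ‖linkEmbed L p.2‖ ≤ rf := by
        rw [Set.mem_compl_iff, Set.mem_union, not_or] at hmem
        have h3 : ¬ (rf / 2 < ‖relLinkVec L (orthoTube L p.1 p.2)‖) := hmem.2
        rw [hrel, not_lt] at h3
        have hrf0 : 0 ≤ rf := le_min (by norm_num) (mul_nonneg (powScale_pos _ _).le (zero_le_one.trans (one_le_btLog β)))
        linarith
      have h := (hwt p.1 p.2 hp hxr hχp).1
      rw [mul_comm (1 + ε), mul_assoc]
      exact mul_le_mul_of_nonneg_left (by rw [mul_comm]; exact h) (sq_nonneg _)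
  rw [hL, hR, ← integral_const_mul]
  exact integral_mono_ae hGi (hRi.const_mul _) hpt

/-! ## §3 The central weight `cWK`: data and floor -/

/-- `cWK` is measurable, bounded by `e^{|E|/powScale 1 β²}`, and nonnegative. [folklore] -/
theorem cWK_props (s K M β : ℝ) :
    Measurable (cWK L s K M β) ∧ (∀ x, |cWK L s K M β x| ≤ Real.exp ((Fintype.card (Edge 3 L) : ℝ) / powScale 1 β ^ 2)) ∧ ∀ x, 0 ≤ cWK L s K M β x := by
  obtain ⟨hm, hb, h0, -⟩ := softWeight_recordChi_props (L := L) s K M β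
  exact ⟨hm.comp (measurable_orthoTube_right (L := L) 1), fun x => hb _, fun x => h0 _⟩

/-- `fibreMass (softWeight χ) Ω_c 1 = ∫ cΘ²·cW dπ`. [folklore] -/
theorem fibreMass_eq_cMass_K (s K M β : ℝ) :
    fibreMass L (softWeight (recordChi L s K M β)) (cΩ L β) 1 = ∫ x, cΘ L β x ^ 2 * cWK L s K M β x ∂orthoTransverse L := rfl

/-- ★★ **WEIGHT FLOOR ON THE PROFILE'S SUPPORT**: `∃ M₀ ≥ 2, ∀ M ≥ M₀, ∀ᶠ β, ∀ x ∈ Bal_cap, ‖x̂‖ ≤ r_f ⇒ ½·fpWeightBar(β^{-1}) ≤ cW x`. [cite: Luscher1983, §3] -/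
theorem eventually_cWK_floor {K : ℝ} (hK : 1 ≤ K) (hLz : Nonempty (NzSite L)) {s : ℝ} (hs : 0 < s) (hs3 : s ≤ 1 / 3) :
    ∃ M₀ : ℝ, 2 ≤ M₀ ∧ ∀ M : ℝ, M₀ ≤ M → ∀ᶠ β : ℝ in atTop, ∀ x ∈ capBalancedSet L, ‖linkEmbed L x‖ ≤ min (1 / 40) (powScale (1 / 2) β * btLog β) →
      fpWeightBar L (powScale 1 β) / 2 ≤ cWK L s K M β x := by
  obtain ⟨M₀, hM₀, H⟩ := fpWeight_record_sandwich_K (L := L) hK hLz hs hs3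
  refine ⟨M₀, hM₀, fun M hM => ?_⟩
  obtain ⟨C, β₀, hC, hP⟩ := H M hM
  have hM2 : 2 ≤ M := hM₀.trans hM
  have hδ : Tendsto (fun β => K * powScale s β) atTop (𝓝 0) := by simpa using (tendsto_powScale hs).const_mul K
  have hδ2 : Tendsto (fun β => (K * powScale s β) ^ 2) atTop (𝓝 0) := by simpa using hδ.pow 2
  filter_upwards [eventually_ge_atTop β₀, eventually_mul_le_of_tendsto hδ2 C (by norm_num : (0 : ℝ) < 1 / 2),
    eventually_orthoTube_one_mem_fatTube_of_norm_le_K (L := L) hK hs (by linarith) hM2] with β hβ₀ hκ hcore x hx hxr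
  have hU := hcore x hxr
  obtain ⟨hlo, -⟩ := hP β hβ₀ _ hU
  have hN0 : 0 < fpWeightBar L (powScale 1 β) := fpWeightBar_pos L (powScale_pos 1 β)
  -- `χ(oT 1 x) = e^{−‖P_Γ x̂‖²/p1²} ∈ (0,1]`
  have hχ : recordChi L s K M β (orthoTube L 1 x) = Real.exp (-(‖(gaugeModes L).starProjection (linkEmbed L x)‖ ^ 2 / powScale 1 β ^ 2)) := by
    rw [recordChi_eq_indicator_mul, Set.indicator_of_mem hU, one_mul, gaugeCoordSq_orthoTube 1 hx]
  have hχpos : 0 < recordChi L s K M β (orthoTube L 1 x) := by rw [hχ]; exact Real.exp_pos _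
  have hχ1 : recordChi L s K M β (orthoTube L 1 x) ≤ 1 := by rw [hχ]; exact Real.exp_le_one_iff.mpr (neg_nonpos.mpr (by positivity))
  have hNlo : fpWeightBar L (powScale 1 β) / 2 ≤ gaugeAvg (recordChi L s K M β) (orthoTube L 1 x) := by
    have h1 : fpWeightBar L (powScale 1 β) * (1 / 2) ≤ fpWeightBar L (powScale 1 β) * (1 - C * (K * powScale s β) ^ 2) :=
      mul_le_mul_of_nonneg_left (by linarith) hN0.le
    linarith
  unfold cWK; rw [softWeight_eq_div, le_div_iff₀ hχpos]
  have hN00 : 0 ≤ gaugeAvg (recordChi L s K M β) (orthoTube L 1 x) := le_trans (by positivity) hNlo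
  nlinarith [mul_le_mul_of_nonneg_left hχ1 hN00]

end Summit.QuantumFields.YangMills.Theorems.FemtoTransferGap.TwoLattice.ConstTube

end
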